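import Summits.QuantumFields.BalabanUV.Beta.CombSlicePairPolarization
import Summits.QuantumFields.BalabanUV.Beta.TwoJetPolarization

/-!
# `BalabanUV.Beta.CombSlicePairJetBridge` — row D1 ∕ (C1), RULING R-D1-g56-1 (C-4) ∕ ADDENDUM -A (A6): **CLAUSES TO SECOND ORDER AT `B = 0`
# SUFFICE — the 2-jet bridge from the by-value gate AT-0 to `CombSlicePairPolarization`**

WHAT ([folklore] finite-dimensional calculus over the tree's one-loop model; literal-agnostic; nothing cited, no `Prop`-valued definition —
the three recurring hypothesis shapes are LOCAL NOTATIONS, spelled out in every statement):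
`CombSlicePairPolarization.polarization_withSlice_forest_eq_forest` asks the dictionary clauses (c1) `Δ(B)·W(B) = 0`, (c2) `Q(B)·W(B) = 0`
EXACTLY on a neighbourhood of `B = 0`; a by-value gate (AT-0 of R-D1-g56-1, the clause test `R-AN2-56-TC`) certifies them only as
2-JETS at `0` (orders 0, 1, 2).  This file (part 2; §1–§4 live in `TwoJetPolarization`, split off for the tree's 400-line rule) proves that the 2-jets are enough
(leaf-01 g40 W-1 l.62528, the «projector trick»):

* §1 `J2Z[f]` (notation) — `f` is `C²` at `0` with vanishing value, first and second derivative there; closed under `+`, `−`, finite sums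
  and multiplication by a `C²` function (Leibniz to second order, via `Literature.AlgebraicGeometry.HodgeTheory.fderiv_fderiv_mul_apply`);
  kills `hessianAt` and `fderiv`.
* §2 entrywise matrix calculus: `EC2[M]` (every entry `C²` at `0`), `EJ2Z[M]` (every entry `J2Z`), closed under products (one `EJ2Z` factor
  suffices), transpose, sums.
* §3 `polarization_eq_of_sub_jet2Zero` — `Beta.polarization` sees only the 2-jet of the data at `0`: two families with `C²` entries whose
  `Q`- and `Δ`-differences are `EJ2Z`, one of them with nondegenerate bordered matrix at `0`, have the same polarization
  (`LogDetHessian`'s Jacobi formula `Family.polarization_eq_trace` on both sides).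
* §4 the PROJECTOR FAMILY `projFamily F W L := (Q·Π, Πᵀ·Δ·Π)`, `Π = 1 − W·L` for ANY `C²` left inverse `L(B)` of `W(B)` (`L·W = 1`; e.g.
  `(τW)⁻¹τ` for an admissible slice): it satisfies (c1) (two-sided) and (c2) EXACTLY at every `B`, and differs from `F` by terms each carrying a
  factor `Δ·W`, `Δᵀ·W` or `Q·W` — hence by `EJ2Z` matrices when those three products are.
* §5 **`polarization_withSlice_forest_eq_forest_of_jetClauses`** — two forest slices `τ`, `P`, directions `W` with a `C²` left inverse, `C²`
  data, the three JET CLAUSES `EJ2Z[Δ·W]`, `EJ2Z[Δᵀ·W]`, `EJ2Z[Q·W]`, and nondegeneracy of the `τ`-sliced bordered matrix AT `B = 0` ONLY ⇒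
  equal polarizations; `torusBetaZero_…` likewise; and the comb-orientation corollary over `combParentOrd σ₁ ∕ σ₂`.
* §6 the slice's OWN left inverse `sliceLeftInv τ W := (τW)⁻¹τ` (`entryC2_inv`: entries of the inverse of a `C²` matrix map with non-zero
  determinant are `C²` — adjugate ∕ determinant; `entryC2_sliceLeftInv`); **`polarization_withSlice_forest_eq_forest_of_jetClauses'`** and
  **`polarization_comb_orientations_eq_of_jetClauses'`** = §5 with the datum `L` and its two hypotheses DISCHARGED (forest slices are unimodular).

WHY: with this file, (III″)'s gate AT-0 ((c1)(c2) ≤ tolerance at orders 0, 1, 2 — by value) is EXACTLY the hypothesis under which AT-2's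
orientation half is a theorem; nothing is left to a journal argument.  WHAT THIS IS NOT: no model of the literal's concrete `τ, P, W, L, Δ, Q`;
nothing of Bałaban's asserted, valued or discharged; 0 estimates; RECORD (ROOT M‴) unchanged; NOT (C1) complete, NOT D1, NEVER «G-an2-4 closed»,
NOT BetaPertH, NOT continuum, NOT Clay.

HONEST DEPENDENCY (page 1, mandatory): continuum YM on T⁴ ⇐ BetaPertH ∧ nine spine estimates (0/9 proved); BetaPertH ⇐ (D1) ∧ (D4) ∧ CAP+tail;
G-an2-4 gates asym, D1 and NE2/3/4.  Row D1 ∕ (C1) OWNER an2, gen 56, 2026-08-25.  No existing file touched.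
-/


noncomputable section

namespace Summit.QuantumFields.BalabanUV.Beta.CombSlicePairJetBridge

open Literature.MathematicalPhysics.QuantumFieldTheory.Balaban1983to89.Beta
open Literature.MathematicalPhysics.QuantumFieldTheory.Balaban1983to89.Beta.GaugeFixing
open Literature.MathematicalPhysics.QuantumFieldTheory.Balaban1983to89.Beta.TreeSliceUnipotent
open Literature.AlgebraicGeometry.HodgeTheory (fderiv_fderiv_mul_apply fderiv_fderiv_add_apply)
open Summit.QuantumFields.BalabanUV.Beta.CombSlicePairPolarization
open Summit.QuantumFields.BalabanUV.Beta.TwoJetPolarization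
open Matrix

variable {ι : Type*} [Fintype ι] [DecidableEq ι]

/-- `J2Z[f]`: `f` is `C²` at `0` and its value, first and second derivative at `0` vanish (hypothesis shape, spelled out). -/
local notation "J2Z[" f "]" =>
  (ContDiffAt ℝ 2 f 0 ∧ f 0 = 0 ∧ fderiv ℝ f 0 = 0 ∧ fderiv ℝ (fderiv ℝ f) 0 = 0)

set_option quotPrecheck false in
/-- `EC2[M]`: every entry of the matrix-valued map `M` is `C²` at `0` (hypothesis shape, spelled out). -/
local notation "EC2[" M "]" => (∀ i j, ContDiffAt ℝ 2 (fun B => M B i j) 0)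

set_option quotPrecheck false in
/-- `EJ2Z[M]`: every entry of the matrix-valued map `M` satisfies `J2Z` (hypothesis shape, spelled out). -/
local notation "EJ2Z[" M "]" => (∀ i j, J2Z[fun B => M B i j])

/-! ## §5. Slicing preserves the regularity and the jets; the bridge -/

section Bridge

variable {n m r : ℕ}

omit [DecidableEq ι] in
/-- [folklore] The sliced constraint `[Q; τ]` is `C²` when `Q` and `τ` are. -/
theorem entryC2_withSlice_Q {F : Family ι n m} {τ : (ι → ℝ) → Matrix (Fin r) (Fin n) ℝ}
    (hQ : EC2[fun B => (F B).Q]) (hτ : EC2[τ]) : EC2[fun B => (withSlice (F B) (τ B)).Q] := by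
  intro i j
  simp only [withSlice_Q, Matrix.reindex_apply, Matrix.submatrix_apply, Equiv.refl_symm, Equiv.coe_refl, id]
  rcases h : finSumFinEquiv.symm i with i' | i'
  · simpa [Matrix.fromRows_apply_inl] using hQ i' j
  · simpa [Matrix.fromRows_apply_inr] using hτ i' j

omit [DecidableEq ι] in
/-- [folklore] Two families sliced by the SAME rows: the sliced constraints differ by a map with vanishing 2-jets when the constraints do. -/
theorem entryJet2Zero_withSlice_Q_sub {F G : Family ι n m} {τ : (ι → ℝ) → Matrix (Fin r) (Fin n) ℝ}
    (h : EJ2Z[fun B => (G B).Q - (F B).Q]) :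
    EJ2Z[fun B => (withSlice (G B) (τ B)).Q - (withSlice (F B) (τ B)).Q] := by
  intro i j
  simp only [withSlice_Q, Matrix.sub_apply, Matrix.reindex_apply, Matrix.submatrix_apply, Equiv.refl_symm, Equiv.coe_refl, id]
  rcases hi : finSumFinEquiv.symm i with i' | i'
  · simpa [Matrix.fromRows_apply_inl] using h i' j
  · simpa [Matrix.fromRows_apply_inr] using (jet2Zero_zero : J2Z[fun _ : ι → ℝ => (0 : ℝ)])

/-- [folklore] **THE 2-JET BRIDGE: TWO FOREST SLICES, ONE POLARIZATION, UNDER JET CLAUSES AT `0`.**  Slices `τ`, `P` whose products with the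
directions `W` are reindexed forest matrices (rank-decreasing forests, unimodular child ends) at every background; a `C²` left inverse `L` of `W`;
`C²` data `Q, Δ, τ, P, W, L`; the JET CLAUSES `Δ·W`, `Δᵀ·W`, `Q·W` with vanishing 2-jets at `0`; and the `τ`-sliced bordered matrix nondegenerate
AT `0`.  Then the `τ`- and `P`-sliced families have the same polarization. -/
theorem polarization_withSlice_forest_eq_forest_of_jetClauses {X₁ X₂ κ : Type*} [Fintype X₁] [DecidableEq X₁] [Fintype X₂]
    [DecidableEq X₂] [Fintype κ] [DecidableEq κ] (F : Family ι n m)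
    (τ P : (ι → ℝ) → Matrix (Fin r) (Fin n) ℝ) (W : (ι → ℝ) → Matrix (Fin n) (Fin r) ℝ) (L : (ι → ℝ) → Matrix (Fin r) (Fin n) ℝ)
    (hLW : ∀ B, L B * W B = 1)
    (e₁ : X₁ × κ ≃ Fin r) (parent₁ : X₁ → Option X₁) (rk₁ : X₁ → ℕ) (hrk₁ : ∀ x y, parent₁ x = some y → rk₁ y < rk₁ x)
    (C₁ A₁ : (ι → ℝ) → X₁ → Matrix κ κ ℝ) (hA₁ : ∀ B x, |(A₁ B x).det| = 1)
    (hτW : ∀ B, τ B * W B = Matrix.reindex e₁ e₁ (forestMatrix parent₁ (C₁ B) (A₁ B)))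
    (e₂ : X₂ × κ ≃ Fin r) (parent₂ : X₂ → Option X₂) (rk₂ : X₂ → ℕ) (hrk₂ : ∀ x y, parent₂ x = some y → rk₂ y < rk₂ x)
    (C₂ A₂ : (ι → ℝ) → X₂ → Matrix κ κ ℝ) (hA₂ : ∀ B x, |(A₂ B x).det| = 1)
    (hPW : ∀ B, P B * W B = Matrix.reindex e₂ e₂ (forestMatrix parent₂ (C₂ B) (A₂ B)))
    (hQ : EC2[fun B => (F B).Q]) (hΔ : EC2[fun B => (F B).Δ]) (hτ : EC2[τ]) (hP : EC2[P]) (hW : EC2[W]) (hL : EC2[L])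
    (c1 : EJ2Z[fun B => (F B).Δ * W B]) (c1t : EJ2Z[fun B => (F B).Δᵀ * W B]) (c2 : EJ2Z[fun B => (F B).Q * W B])
    (hdet : (withSlice (F 0) (τ 0)).kkt.det ≠ 0) :
    polarization (fun B => withSlice (F B) (τ B)) = polarization (fun B => withSlice (F B) (P B)) := by
  set G : Family ι n m := projFamily F W L with hG
  -- regularity of G and the jets of G − F
  have hGQ : EC2[fun B => (G B).Q] := entryC2_projFamily_Q hQ hW hL
  have hGΔ : EC2[fun B => (G B).Δ] := entryC2_projFamily_Δ hΔ hW hL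
  have jQ : EJ2Z[fun B => (G B).Q - (F B).Q] := entryJet2Zero_projFamily_Q_sub hL c2
  have jΔ : EJ2Z[fun B => (G B).Δ - (F B).Δ] := entryJet2Zero_projFamily_Δ_sub hW hL c1 c1t
  -- sliced regularity / jets (the form of a sliced datum is the unsliced form)
  have sFQτ := entryC2_withSlice_Q (τ := τ) hQ hτ
  have sFQP := entryC2_withSlice_Q (τ := P) hQ hP
  have sGQτ := entryC2_withSlice_Q (τ := τ) hGQ hτ
  have sGQP := entryC2_withSlice_Q (τ := P) hGQ hP
  have sFΔτ : EC2[fun B => (withSlice (F B) (τ B)).Δ] := fun i j => by simpa only [withSlice_Δ] using hΔ i j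
  have sFΔP : EC2[fun B => (withSlice (F B) (P B)).Δ] := fun i j => by simpa only [withSlice_Δ] using hΔ i j
  have sGΔτ : EC2[fun B => (withSlice (G B) (τ B)).Δ] := fun i j => by simpa only [withSlice_Δ] using hGΔ i j
  have sGΔP : EC2[fun B => (withSlice (G B) (P B)).Δ] := fun i j => by simpa only [withSlice_Δ] using hGΔ i j
  have jQτ := entryJet2Zero_withSlice_Q_sub (τ := τ) jQ
  have jQP := entryJet2Zero_withSlice_Q_sub (τ := P) jQ
  have jΔτ : EJ2Z[fun B => (withSlice (G B) (τ B)).Δ - (withSlice (F B) (τ B)).Δ] :=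
    fun i j => by simpa only [withSlice_Δ] using jΔ i j
  have jΔP : EJ2Z[fun B => (withSlice (G B) (P B)).Δ - (withSlice (F B) (P B)).Δ] :=
    fun i j => by simpa only [withSlice_Δ] using jΔ i j
  -- values at 0: G 0 = F 0
  have hQ0 : (G 0).Q = (F 0).Q := sub_eq_zero.mp (apply_zero_of_entryJet2Zero jQ)
  have hΔ0 : (G 0).Δ = (F 0).Δ := sub_eq_zero.mp (apply_zero_of_entryJet2Zero jΔ)
  have hG0 : G 0 = F 0 := by
    cases hF0 : F 0 with
    | mk Q0 Δ0 =>
      have h1 : (G 0).Q = Q0 := by rw [hQ0, hF0]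
      have h2 : (G 0).Δ = Δ0 := by rw [hΔ0, hF0]
      cases hG0' : G 0 with
      | mk Q1 Δ1 =>
        rw [hG0'] at h1 h2
        simp only at h1 h2
        rw [h1, h2]
  -- exact clauses at B = 0 for F itself (values of the jet clauses)
  have c10 : (F 0).Δ * W 0 = 0 := apply_zero_of_entryJet2Zero c1
  have c1t0 : (F 0).Δᵀ * W 0 = 0 := apply_zero_of_entryJet2Zero c1t
  have c20 : (F 0).Q * W 0 = 0 := apply_zero_of_entryJet2Zero c2
  have uτ : IsUnit (τ 0 * W 0).det := isUnit_det_of_forest τ W e₁ parent₁ rk₁ hrk₁ C₁ A₁ hA₁ hτW 0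
  have uP : IsUnit (P 0 * W 0).det := isUnit_det_of_forest P W e₂ parent₂ rk₂ hrk₂ C₂ A₂ hA₂ hPW 0
  -- nondegeneracy on the P side at 0, from the τ side (linearised Faddeev–Popov determinant identity)
  have hdetP : (withSlice (F 0) (P 0)).kkt.det ≠ 0 := by
    have h := det_kkt_fromRows_slice_change (F 0).Δ (F 0).Q (τ 0) (P 0) (W 0) c10 c1t0 c20 uτ uP
    rw [det_kkt_withSlice] at hdet ⊢
    intro h0
    rw [h0, zero_mul] at h
    have hP2 : (P 0 * W 0).det ^ 2 ≠ 0 := pow_ne_zero 2 uP.ne_zero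
    exact (mul_ne_zero hdet hP2) h.symm
  -- step 1: F ↦ G on the τ slice
  have step1 : polarization (fun B => withSlice (F B) (τ B)) = polarization (fun B => withSlice (G B) (τ B)) :=
    polarization_eq_of_sub_jet2Zero (fun B => withSlice (F B) (τ B)) (fun B => withSlice (G B) (τ B))
      sFQτ sFΔτ sGQτ sGΔτ hdet jQτ jΔτ
  -- step 2: G satisfies the clauses exactly; change the slice
  have hdetG : (withSlice (G 0) (τ 0)).kkt.det ≠ 0 := by rw [hG0]; exact hdet
  have hcont : ContinuousAt (fun B => (withSlice (G B) (τ B)).kkt.det) 0 :=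
    (Family.contDiffAt_det_kkt (fun B => withSlice (G B) (τ B)) (k := 2) sGQτ sGΔτ).continuousAt
  have hev : ∀ᶠ B in nhds 0, (withSlice (G B) (τ B)).kkt.det ≠ 0 := hcont.eventually_ne hdetG
  have step2 : polarization (fun B => withSlice (G B) (τ B)) = polarization (fun B => withSlice (G B) (P B)) := by
    refine polarization_withSlice_forest_eq_forest G τ P W e₁ parent₁ rk₁ hrk₁ C₁ A₁ hA₁ hτW e₂ parent₂ rk₂ hrk₂ C₂ A₂ hA₂
      hPW ?_
    filter_upwards [hev] with B hB
    exact ⟨projFamily_Δ_mul_W F W L hLW B, projFamily_Δ_transpose_mul_W F W L hLW B, projFamily_Q_mul_W F W L hLW B, hB⟩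
  -- step 3: G ↦ F on the P slice
  have step3 : polarization (fun B => withSlice (F B) (P B)) = polarization (fun B => withSlice (G B) (P B)) :=
    polarization_eq_of_sub_jet2Zero (fun B => withSlice (F B) (P B)) (fun B => withSlice (G B) (P B))
      sFQP sFΔP sGQP sGΔP hdetP jQP jΔP
  rw [step1, step2, ← step3]

/-- [folklore] … hence the same torus one-loop coefficient `β⁰_T`. -/
theorem torusBetaZero_withSlice_forest_eq_forest_of_jetClauses {X₁ X₂ κ : Type*} [Fintype X₁] [DecidableEq X₁]
    [Fintype X₂] [DecidableEq X₂] [Fintype κ] [DecidableEq κ] {d s c : ℕ} [NeZero s] (F : Family (ExtIndex d s c) n m)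
    (τ P : (ExtIndex d s c → ℝ) → Matrix (Fin r) (Fin n) ℝ) (W : (ExtIndex d s c → ℝ) → Matrix (Fin n) (Fin r) ℝ)
    (L : (ExtIndex d s c → ℝ) → Matrix (Fin r) (Fin n) ℝ) (hLW : ∀ B, L B * W B = 1)
    (e₁ : X₁ × κ ≃ Fin r) (parent₁ : X₁ → Option X₁) (rk₁ : X₁ → ℕ) (hrk₁ : ∀ x y, parent₁ x = some y → rk₁ y < rk₁ x)
    (C₁ A₁ : (ExtIndex d s c → ℝ) → X₁ → Matrix κ κ ℝ) (hA₁ : ∀ B x, |(A₁ B x).det| = 1)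
    (hτW : ∀ B, τ B * W B = Matrix.reindex e₁ e₁ (forestMatrix parent₁ (C₁ B) (A₁ B)))
    (e₂ : X₂ × κ ≃ Fin r) (parent₂ : X₂ → Option X₂) (rk₂ : X₂ → ℕ) (hrk₂ : ∀ x y, parent₂ x = some y → rk₂ y < rk₂ x)
    (C₂ A₂ : (ExtIndex d s c → ℝ) → X₂ → Matrix κ κ ℝ) (hA₂ : ∀ B x, |(A₂ B x).det| = 1)
    (hPW : ∀ B, P B * W B = Matrix.reindex e₂ e₂ (forestMatrix parent₂ (C₂ B) (A₂ B)))
    (hQ : ∀ i j, ContDiffAt ℝ 2 (fun B => (F B).Q i j) 0) (hΔ : ∀ i j, ContDiffAt ℝ 2 (fun B => (F B).Δ i j) 0)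
    (hτ : ∀ i j, ContDiffAt ℝ 2 (fun B => τ B i j) 0) (hP : ∀ i j, ContDiffAt ℝ 2 (fun B => P B i j) 0)
    (hW : ∀ i j, ContDiffAt ℝ 2 (fun B => W B i j) 0) (hL : ∀ i j, ContDiffAt ℝ 2 (fun B => L B i j) 0)
    (c1 : EJ2Z[fun B => (F B).Δ * W B]) (c1t : EJ2Z[fun B => (F B).Δᵀ * W B]) (c2 : EJ2Z[fun B => (F B).Q * W B])
    (hdet : (withSlice (F 0) (τ 0)).kkt.det ≠ 0) (a₀ : Fin c) (μ ν : Fin d) :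
    torusBetaZero (fun B => withSlice (F B) (τ B)) a₀ μ ν = torusBetaZero (fun B => withSlice (F B) (P B)) a₀ μ ν :=
  torusBetaZero_eq_of_polarization_eq _ _
    (polarization_withSlice_forest_eq_forest_of_jetClauses F τ P W L hLW e₁ parent₁ rk₁ hrk₁ C₁ A₁ hA₁ hτW e₂ parent₂ rk₂
      hrk₂ C₂ A₂ hA₂ hPW hQ hΔ hτ hP hW hL c1 c1t c2 hdet) a₀ μ ν

/-- [folklore] **TWO COMB ORIENTATIONS, ONE POLARIZATION, UNDER JET CLAUSES** — the by-value gate AT-0 read as a theorem: comb forests of one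
block in the axis orders `σ₁`, `σ₂` (`CombSlicePairPolarization.combParentOrd`). -/
theorem polarization_comb_orientations_eq_of_jetClauses {d L₀ : ℕ} [NeZero L₀] {κ : Type*} [Fintype κ] [DecidableEq κ]
    (σ₁ σ₂ : Equiv.Perm (Fin d)) (F : Family ι n m)
    (τ P : (ι → ℝ) → Matrix (Fin r) (Fin n) ℝ) (W : (ι → ℝ) → Matrix (Fin n) (Fin r) ℝ) (L : (ι → ℝ) → Matrix (Fin r) (Fin n) ℝ)
    (hLW : ∀ B, L B * W B = 1) (e₁ e₂ : CombVertex d L₀ × κ ≃ Fin r)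
    (C₁ A₁ C₂ A₂ : (ι → ℝ) → CombVertex d L₀ → Matrix κ κ ℝ) (hA₁ : ∀ B x, |(A₁ B x).det| = 1)
    (hA₂ : ∀ B x, |(A₂ B x).det| = 1)
    (hτW : ∀ B, τ B * W B = Matrix.reindex e₁ e₁ (forestMatrix (combParentOrd σ₁) (C₁ B) (A₁ B)))
    (hPW : ∀ B, P B * W B = Matrix.reindex e₂ e₂ (forestMatrix (combParentOrd σ₂) (C₂ B) (A₂ B)))
    (hQ : ∀ i j, ContDiffAt ℝ 2 (fun B => (F B).Q i j) 0) (hΔ : ∀ i j, ContDiffAt ℝ 2 (fun B => (F B).Δ i j) 0)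
    (hτ : ∀ i j, ContDiffAt ℝ 2 (fun B => τ B i j) 0) (hP : ∀ i j, ContDiffAt ℝ 2 (fun B => P B i j) 0)
    (hW : ∀ i j, ContDiffAt ℝ 2 (fun B => W B i j) 0) (hL : ∀ i j, ContDiffAt ℝ 2 (fun B => L B i j) 0)
    (c1 : EJ2Z[fun B => (F B).Δ * W B]) (c1t : EJ2Z[fun B => (F B).Δᵀ * W B]) (c2 : EJ2Z[fun B => (F B).Q * W B])
    (hdet : (withSlice (F 0) (τ 0)).kkt.det ≠ 0) :
    polarization (fun B => withSlice (F B) (τ B)) = polarization (fun B => withSlice (F B) (P B)) :=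
  polarization_withSlice_forest_eq_forest_of_jetClauses F τ P W L hLW e₁ (combParentOrd σ₁) combRank
    (fun x y hxy => combParentOrd_rank_lt σ₁ x y hxy) C₁ A₁ hA₁ hτW e₂ (combParentOrd σ₂) combRank
    (fun x y hxy => combParentOrd_rank_lt σ₂ x y hxy) C₂ A₂ hA₂ hPW hQ hΔ hτ hP hW hL c1 c1t c2 hdet

end Bridge

/-! ## §6. The slice's own left inverse: `L := (τW)⁻¹τ` is a `C²` left inverse whenever `τW` is unimodular (no extra datum for forest slices) -/

section SliceLeftInverse

variable {n r : ℕ}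

/-- [folklore] The left inverse of the directions supplied by an admissible slice: `L(B) := (τ(B)W(B))⁻¹ τ(B)`. -/
def sliceLeftInv (τ : (ι → ℝ) → Matrix (Fin r) (Fin n) ℝ) (W : (ι → ℝ) → Matrix (Fin n) (Fin r) ℝ) (B : ι → ℝ) :
    Matrix (Fin r) (Fin n) ℝ :=
  (τ B * W B)⁻¹ * τ B

omit [Fintype ι] [DecidableEq ι] in
/-- [folklore] `L·W = 1` wherever `τW` is invertible. -/
theorem sliceLeftInv_mul_W (τ : (ι → ℝ) → Matrix (Fin r) (Fin n) ℝ) (W : (ι → ℝ) → Matrix (Fin n) (Fin r) ℝ) (B : ι → ℝ)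
    (h : IsUnit (τ B * W B).det) : sliceLeftInv τ W B * W B = 1 := by
  rw [sliceLeftInv, Matrix.mul_assoc, Matrix.nonsing_inv_mul _ h]

omit [DecidableEq ι] in
/-- [folklore] Entries of the inverse of a `C²` matrix map with nonvanishing determinant at `0` are `C²` at `0` (adjugate ∕ determinant). -/
theorem entryC2_inv {A : (ι → ℝ) → Matrix (Fin r) (Fin r) ℝ} (hA : EC2[A]) (hdet : (A 0).det ≠ 0) : EC2[fun B => (A B)⁻¹] := by
  intro i j
  have hdetC2 : ContDiffAt ℝ 2 (fun B => (A B).det) 0 := contDiffAt_matrix_det hA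
  have hadj : ContDiffAt ℝ 2 (fun B => (A B).adjugate i j) 0 := by
    have h : ∀ B, (A B).adjugate i j = ((A B).updateRow j (Pi.single i 1)).det := fun B => Matrix.adjugate_apply _ _ _
    simp_rw [h]
    refine contDiffAt_matrix_det fun a b => ?_
    by_cases ha : a = j
    · subst ha
      simp only [Matrix.updateRow_self]
      exact contDiffAt_const
    · simp only [Matrix.updateRow_ne ha]
      exact hA a b
  have h : ∀ B, (A B)⁻¹ i j = ((A B).det)⁻¹ * (A B).adjugate i j := by
    intro B
    rw [Matrix.inv_def, Matrix.smul_apply, Ring.inverse_eq_inv', smul_eq_mul]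
  simp_rw [h]
  exact (hdetC2.inv hdet).mul hadj

omit [DecidableEq ι] in
/-- [folklore] `C²` slice and directions with `det(τ(0)W(0)) ≠ 0` ⇒ the slice's left inverse is `C²` at `0`. -/
theorem entryC2_sliceLeftInv {τ : (ι → ℝ) → Matrix (Fin r) (Fin n) ℝ} {W : (ι → ℝ) → Matrix (Fin n) (Fin r) ℝ}
    (hτ : EC2[τ]) (hW : EC2[W]) (hdet : (τ 0 * W 0).det ≠ 0) : EC2[sliceLeftInv τ W] :=
  entryC2_mul (entryC2_inv (entryC2_mul hτ hW) hdet) hτ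

/-- [folklore] **THE 2-JET BRIDGE WITH NO EXTRA DATUM**: for forest slices the left inverse is the slice's own `(τW)⁻¹τ` (unimodular `τW`), so
`polarization_withSlice_forest_eq_forest_of_jetClauses` holds with the hypotheses on `L` discharged. -/
theorem polarization_withSlice_forest_eq_forest_of_jetClauses' {m : ℕ} {X₁ X₂ κ : Type*} [Fintype X₁] [DecidableEq X₁]
    [Fintype X₂] [DecidableEq X₂] [Fintype κ] [DecidableEq κ] (F : Family ι n m)
    (τ P : (ι → ℝ) → Matrix (Fin r) (Fin n) ℝ) (W : (ι → ℝ) → Matrix (Fin n) (Fin r) ℝ)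
    (e₁ : X₁ × κ ≃ Fin r) (parent₁ : X₁ → Option X₁) (rk₁ : X₁ → ℕ) (hrk₁ : ∀ x y, parent₁ x = some y → rk₁ y < rk₁ x)
    (C₁ A₁ : (ι → ℝ) → X₁ → Matrix κ κ ℝ) (hA₁ : ∀ B x, |(A₁ B x).det| = 1)
    (hτW : ∀ B, τ B * W B = Matrix.reindex e₁ e₁ (forestMatrix parent₁ (C₁ B) (A₁ B)))
    (e₂ : X₂ × κ ≃ Fin r) (parent₂ : X₂ → Option X₂) (rk₂ : X₂ → ℕ) (hrk₂ : ∀ x y, parent₂ x = some y → rk₂ y < rk₂ x)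
    (C₂ A₂ : (ι → ℝ) → X₂ → Matrix κ κ ℝ) (hA₂ : ∀ B x, |(A₂ B x).det| = 1)
    (hPW : ∀ B, P B * W B = Matrix.reindex e₂ e₂ (forestMatrix parent₂ (C₂ B) (A₂ B)))
    (hQ : EC2[fun B => (F B).Q]) (hΔ : EC2[fun B => (F B).Δ]) (hτ : EC2[τ]) (hP : EC2[P]) (hW : EC2[W])
    (c1 : EJ2Z[fun B => (F B).Δ * W B]) (c1t : EJ2Z[fun B => (F B).Δᵀ * W B]) (c2 : EJ2Z[fun B => (F B).Q * W B])
    (hdet : (withSlice (F 0) (τ 0)).kkt.det ≠ 0) :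
    polarization (fun B => withSlice (F B) (τ B)) = polarization (fun B => withSlice (F B) (P B)) := by
  have uτ : ∀ B, IsUnit (τ B * W B).det := fun B => isUnit_det_of_forest τ W e₁ parent₁ rk₁ hrk₁ C₁ A₁ hA₁ hτW B
  exact polarization_withSlice_forest_eq_forest_of_jetClauses F τ P W (sliceLeftInv τ W)
    (fun B => sliceLeftInv_mul_W τ W B (uτ B)) e₁ parent₁ rk₁ hrk₁ C₁ A₁ hA₁ hτW e₂ parent₂ rk₂ hrk₂ C₂ A₂ hA₂ hPW hQ hΔ hτ hP hW
    (entryC2_sliceLeftInv hτ hW (uτ 0).ne_zero) c1 c1t c2 hdet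

/-- [folklore] … and the comb-orientation form with no extra datum. -/
theorem polarization_comb_orientations_eq_of_jetClauses' {m d L₀ : ℕ} [NeZero L₀] {κ : Type*} [Fintype κ] [DecidableEq κ]
    (σ₁ σ₂ : Equiv.Perm (Fin d)) (F : Family ι n m)
    (τ P : (ι → ℝ) → Matrix (Fin r) (Fin n) ℝ) (W : (ι → ℝ) → Matrix (Fin n) (Fin r) ℝ) (e₁ e₂ : CombVertex d L₀ × κ ≃ Fin r)
    (C₁ A₁ C₂ A₂ : (ι → ℝ) → CombVertex d L₀ → Matrix κ κ ℝ) (hA₁ : ∀ B x, |(A₁ B x).det| = 1)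
    (hA₂ : ∀ B x, |(A₂ B x).det| = 1)
    (hτW : ∀ B, τ B * W B = Matrix.reindex e₁ e₁ (forestMatrix (combParentOrd σ₁) (C₁ B) (A₁ B)))
    (hPW : ∀ B, P B * W B = Matrix.reindex e₂ e₂ (forestMatrix (combParentOrd σ₂) (C₂ B) (A₂ B)))
    (hQ : EC2[fun B => (F B).Q]) (hΔ : EC2[fun B => (F B).Δ]) (hτ : EC2[τ]) (hP : EC2[P]) (hW : EC2[W])
    (c1 : EJ2Z[fun B => (F B).Δ * W B]) (c1t : EJ2Z[fun B => (F B).Δᵀ * W B]) (c2 : EJ2Z[fun B => (F B).Q * W B])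
    (hdet : (withSlice (F 0) (τ 0)).kkt.det ≠ 0) :
    polarization (fun B => withSlice (F B) (τ B)) = polarization (fun B => withSlice (F B) (P B)) :=
  polarization_withSlice_forest_eq_forest_of_jetClauses' F τ P W e₁ (combParentOrd σ₁) combRank
    (fun x y hxy => combParentOrd_rank_lt σ₁ x y hxy) C₁ A₁ hA₁ hτW e₂ (combParentOrd σ₂) combRank
    (fun x y hxy => combParentOrd_rank_lt σ₂ x y hxy) C₂ A₂ hA₂ hPW hQ hΔ hτ hP hW c1 c1t c2 hdet

end SliceLeftInverse

end Summit.QuantumFields.BalabanUV.Beta.CombSlicePairJetBridge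

end
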